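import Summits.ABC.ABC.Theorems.TwistAmplificationSharpModerateLawConeDefs

/-!
# Crux `TwistAmplification.SharpModerateLaw` (stmt-ABC-1975): the canonical open core in Szpiro-robust form

Lead `prover-line-stmt-ABC-1975-c4-0` (seventh lead seat), 2026-08-16. After cycle 1 of this seat every line of the crux is built out
and all residues are known to follow from the census core (`SpreadLawCone ↔ IndexFormShellLawCone`, `…UniformityDischarge.lean`;
`IndexFormShellLawCone → CuspLawD`, `…CensusToDispersion.lean`). The landed law statements, however, differ by ARTEFACTS of their
dyadic conventions — cone apertures `X³ ≤ 2Y` (census side) vs `X³ ≤ 8Y` (dispersion side), level factors `186624 = 2⁶3⁶` and `16`,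
conductor proxies `N5` (primes `≥ 5`) vs `N*` (all primes), `(XY)^ε` vs `X^ε`, shells `[Y, 2Y)` vs `(Y/2, Y]` — which obstruct formal
equivalences exactly in a `κ ≈ 3` sliver and at the Szpiro edge `Y ≈ X^σ`, regions the crux never uses: its transfer
(`cuspTransferCone`) consumes the cusp law only on shells with `X_j^κ ≤ 2·2^j`, `κ > 3` FIXED, i.e. on `X^{κ₀} ≤ Y` for any
`3 < κ₀ < κ`.

This file types the SZPIRO-ROBUST form of the core, in which every such constant is absorbed (a factor `c` in `X^{κ₀} ≤ c·Y` is
traded for a smaller `κ₀`, a factor in `Y ≤ c·X^σ` for a larger `σ`, bounded `X` for the constant `C` since then `Y ≤ X^σ` is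
bounded too):

* `CoreLaw` — cusp side, the most elementary coordinates (tower-free integer pairs `(c₄, c₆)` with `1728 ∣ c₄³ − c₆²`, dyadic level
  `Y ≤ M⁺ < 2Y`, conductor proxy `N5cusp ≤ X` over the primes `≥ 5`): for all `3 < κ₀ < σ` and `ε > 0`,
  `#cuspShell(X, Y) ≤ C · (XY)^ε · (X·Y^{-1/6} + 1)` whenever `X^{κ₀} ≤ Y ≤ X^σ`;
* `CoreLawIF` — the same for index-form data of maximal cubic rings (`totalCount ⊤`).

Both are formally WEAKER than the landed cone laws (`coreLaw_of_cuspShellLawCone`, `coreLawIF_of_indexFormShellLawCone`, proved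
here: the robust region lies inside every cone used so far). The theorems `CoreLaw → SharpModerateLaw`, `CuspLawD → CoreLaw`,
`CoreLawIF → CoreLaw` and the inverse dictionary `CoreLaw → CoreLawIF` are the business of the accompanying proof files; with them
`CoreLaw` is the one canonical statement every line of the crux reduces to and which still implies the crux.
-/

noncomputable section

-- the mandated summit namespace `Summit.ABC.ABC` (summit = problem) trips the duplicate-namespace linter
set_option linter.dupNamespace false

namespace Summit.ABC.ABC.Theorems.SharpModerateLaw

/-- **The canonical open core of the crux, cusp side, Szpiro-robust form.** For all `3 < κ₀ < σ` and `ε > 0` there is `C`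
with `#cuspShell(X, Y) ≤ C · (XY)^ε · (X·Y^{-1/6} + 1)` for all `X, Y ≥ 1` with `X^{κ₀} ≤ Y ≤ X^σ` (tower-free `(c₄, c₆)` with
`c₄c₆ ≠ 0`, `1728 ∣ c₄³ − c₆² ≠ 0`, `Y ≤ M⁺ < 2Y`, `N5cusp ≤ X`). -/
def CoreLaw : Prop :=
  ∀ κ₀ σ : ℝ, 3 < κ₀ → κ₀ < σ → ∀ ε : ℝ, 0 < ε → ∃ C : ℝ, ∀ X Y : ℝ, 1 ≤ X → 1 ≤ Y → X ^ κ₀ ≤ Y → Y ≤ X ^ σ →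
    (Set.ncard (cuspShell X Y) : ℝ) ≤ C * (X * Y) ^ ε * (X * Y ^ (-(1 / 6 : ℝ)) + 1)

/-- **The canonical open core, index-form side, Szpiro-robust form**: the same law for the total count of index-form shell data
over the maximal cubic rings of discriminant `0 < |D| ≤ 2Y` (`totalCount ⊤ X Y`). -/
def CoreLawIF : Prop :=
  ∀ κ₀ σ : ℝ, 3 < κ₀ → κ₀ < σ → ∀ ε : ℝ, 0 < ε → ∃ C : ℝ, ∀ X Y : ℝ, 1 ≤ X → 1 ≤ Y → X ^ κ₀ ≤ Y → Y ≤ X ^ σ →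
    (totalCount (fun _ _ _ _ => True) X Y : ℝ) ≤ C * (X * Y) ^ ε * (X * Y ^ (-(1 / 6 : ℝ)) + 1)

/-- The robust region lies in the aperture-2 cone: `X ≥ 1`, `3 < κ₀`, `X^{κ₀} ≤ Y` give `X³ ≤ 2Y`. -/
theorem pow_three_le_two_mul_of_rpow_le {κ₀ X Y : ℝ} (hκ₀ : 3 < κ₀) (hX : 1 ≤ X) (hY : X ^ κ₀ ≤ Y) :
    X ^ 3 ≤ 2 * Y := by
  have h3 : X ^ (3 : ℝ) ≤ X ^ κ₀ := Real.rpow_le_rpow_of_exponent_le hX hκ₀.le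
  have h3' : X ^ (3 : ℝ) = X ^ (3 : ℕ) := by exact_mod_cast Real.rpow_natCast X 3
  have hY0 : 0 ≤ Y := le_trans (Real.rpow_nonneg (by linarith) κ₀) hY
  rw [h3'] at h3
  linarith

/-- The robust region lies under every Szpiro cap `X^{σ'}`, `σ ≤ σ'`. -/
theorem le_rpow_of_le_rpow_of_le {σ σ' X Y : ℝ} (hX : 1 ≤ X) (hσ : σ ≤ σ') (hY : Y ≤ X ^ σ) : Y ≤ X ^ σ' :=
  hY.trans (Real.rpow_le_rpow_of_exponent_le hX hσ)

/-- **`CuspShellLawCone → CoreLaw`**: the robust core is formally weaker than the cone-restricted cusp shell law. -/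
theorem coreLaw_of_cuspShellLawCone : CuspShellLawCone → CoreLaw := by
  intro h κ₀ σ hκ₀ _ ε hε
  obtain ⟨C, hC⟩ := h (max σ 7) (lt_of_lt_of_le (by norm_num) (le_max_right σ 7)) ε hε
  exact ⟨C, fun X Y hX hY hlo hhi => hC X Y hX hY (pow_three_le_two_mul_of_rpow_le hκ₀ hX hlo)
    (le_rpow_of_le_rpow_of_le hX (le_max_left σ 7) hhi)⟩

/-- **`IndexFormShellLawCone → CoreLawIF`**: the robust index-form core is formally weaker than the cone index-form shell law. -/
theorem coreLawIF_of_indexFormShellLawCone : IndexFormShellLawCone → CoreLawIF := by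
  intro h κ₀ σ hκ₀ _ ε hε
  obtain ⟨C, hC⟩ := h (max σ 7) (lt_of_lt_of_le (by norm_num) (le_max_right σ 7)) ε hε
  refine ⟨C, fun X Y hX hY hlo hhi => hC X Y hX hY (pow_three_le_two_mul_of_rpow_le hκ₀ hX hlo) ?_⟩
  have h1 : Y ≤ X ^ (max σ 7) := le_rpow_of_le_rpow_of_le hX (le_max_left σ 7) hhi
  have hXσ : 0 ≤ X ^ (max σ 7) := Real.rpow_nonneg (by linarith) _
  linarith

end Summit.ABC.ABC.Theorems.SharpModerateLaw

end
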